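import Literature.Geometry.Lorentzian.CoordShrinkerScalarGradientBound
import Literature.Geometry.Riemannian.ShrinkerCutoffFamily
import HarnessLib

/-!
# Stubs S4 `helper_mwScalarGradientBound` and S6 `helper_mwCutoffFamily` of line `collapsed-ends-usc`
# — crux `EntropyRung.NoncompactShrinkerGap` (stmt-SmoothPoincare4-10868)

Two registered helper stubs of the Munteanu–Wang programme (Compositio Math. 151 (2015), Thm. 1.4:
a complete four-dimensional gradient shrinking Ricci soliton with bounded scalar curvature has
bounded curvature), both PROVED in Literature and restated here verbatim:

* `helper_mwScalarGradientBound` — the chart-level Cauchy–Schwarz consequence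
  `|∇S|² ≤ 4 |Ric|² |∇f|²` of Hamilton's identity `∇S = 2 Ric(∇f, ·)` on a gradient soliton
  `Ric + Hess f = ½ G` (`MetricCoord.IsMetricOn.gradSqAt_scalAt_le_of_soliton`,
  `Literature/Geometry/Lorentzian/CoordShrinkerScalarGradientBound.lean`), the gradient term of
  the differential inequality for `u = |Ric|² S^{-a}` (Munteanu–Wang 2015, proof of Lemma 1.2);
* `helper_mwCutoffFamily` — the cut-off family `Θ_A(f)` of the localised maximum principle with a
  general drift constant `μ` (`Δ_f f = μ − f`, `μ = n/2`), i.e. Zhang's cut-off rescaled to the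
  potential (`ShrinkerCutoff.exists_cutoff_family`,
  `Literature/Geometry/Riemannian/ShrinkerCutoffFamily.lean`).
-/

noncomputable section

set_option linter.dupNamespace false

open Set Filter Module
open scoped ContDiff Topology

namespace Summit.SmoothPoincare4.SmoothPoincare4.Theorems.NoncompactShrinkerGapMW

open Literature.Geometry.Lorentzian Literature.Geometry.Riemannian

/-- **Stub S4 `helper_mwScalarGradientBound` of line `collapsed-ends-usc`** (crux
`EntropyRung.NoncompactShrinkerGap`, stmt-SmoothPoincare4-10868): the registered signature —
`|∇S|²_G (x) ≤ 4 |Ric|²_G (x) |∇f|²_G (x)` for metric components with `Ric + Hess f = ½ G` on `V`,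
positive definite on `V`, at `x ∈ V`. From `IsMetricOn.gradSqAt_scalAt_le_of_soliton` (`λ = ½`,
positivity used at `x` only). [cite: MunteanuWang2015, Lemma 1.2 (proof)] [cite: Hamilton1995, §20] -/
theorem helper_mwScalarGradientBound : ∀ {E : Type} [NormedAddCommGroup E] [NormedSpace ℝ E] [FiniteDimensional ℝ E] [CompleteSpace E] (G : E → E →L[ℝ] E →L[ℝ] ℝ) (V : Set E) (x : E) (f : E → ℝ), MetricCoord.IsMetricOn G V → x ∈ V → (∀ y ∈ V, ∀ v : E, v ≠ 0 → 0 < G y v v) → ContDiffOn ℝ ∞ f V → (∀ y ∈ V, ∀ v w : E, MetricCoord.ricAt G y v w + MetricCoord.hessAt G f y v w = (1 / 2 : ℝ) * G y v w) → MetricCoord.gradSqAt G (MetricCoord.scalAt G) x ≤ 4 * MetricCoord.normSqAt G x (MetricCoord.ricAt G x) * MetricCoord.gradSqAt G f x :=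
  fun _ _ x _ hG hx hpos hf hsol ↦ hG.gradSqAt_scalAt_le_of_soliton hx (hpos x hx) hf hsol

/-- **Stub S6 `helper_mwCutoffFamily` of line `collapsed-ends-usc`** (crux
`EntropyRung.NoncompactShrinkerGap`, stmt-SmoothPoincare4-10868): the registered signature — the
cut-off family `Θ_A(t) = ψ(t/(2A))` with a general drift constant `1 ≤ μ ≤ A`: `Θ = 1` on
`(-∞, A]`, `Θ = 0` on `[2A, ∞)`, `0 ≤ Θ ≤ 1`, `Θ' ≤ 0`, and
`-(Θ'' g + Θ' (μ − t)) + 2 Θ'² g / Θ ≤ K / A` whenever `Θ(t) > 0`, `0 ≤ g ≤ t`. This is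
`ShrinkerCutoff.exists_cutoff_family` (hypotheses `0 < A`, `μ ≤ A`) specialised to `1 ≤ μ ≤ A`.
[cite: Zhang2009, proof of Thm. 1.3, Step 1] -/
theorem helper_mwCutoffFamily : ∃ K : ℝ, 0 ≤ K ∧ ∀ μ A : ℝ, 1 ≤ μ → μ ≤ A → ∃ Θ Θ' Θ'' : ℝ → ℝ, (∀ t, HasDerivAt Θ (Θ' t) t) ∧ (∀ t, HasDerivAt Θ' (Θ'' t) t) ∧ (∀ t, t ≤ A → Θ t = 1) ∧ (∀ t, 2 * A ≤ t → Θ t = 0) ∧ (∀ t, 0 ≤ Θ t ∧ Θ t ≤ 1) ∧ (∀ t, Θ' t ≤ 0) ∧ (∀ t g : ℝ, 0 < Θ t → 0 ≤ g → g ≤ t → -(Θ'' t * g + Θ' t * (μ - t)) + 2 * (Θ' t) ^ 2 * g / Θ t ≤ K / A) := by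
  obtain ⟨K, hK, h⟩ := ShrinkerCutoff.exists_cutoff_family
  exact ⟨K, hK, fun μ A hμ hμA ↦ h μ A (by linarith) hμA⟩

end Summit.SmoothPoincare4.SmoothPoincare4.Theorems.NoncompactShrinkerGapMW

end
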